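import Summits.ResolutionOfSingularities.ResolutionOfSingularities.Theorems.EquisingularLiftEquisingularLiftNatResidueHypDefsE8
import Summits.ResolutionOfSingularities.ResolutionOfSingularities.Theorems.EquisingularLiftEquisingularLiftNatNoseRoundStageOfModel
import Literature.AlgebraicGeometry.Motives.ReducedClosedSubschemeIso
import HarnessLib

/-!
# [OURS · L1 W4.5(b) · EL♮(3) · WIDTH TABLE D15 «ν-LIFT DOOR»] THE `S = ∅` INSTANCE OF THE ν-LIFT SLOT:
# «a regular `O`-flat model of the nose over every admissible `(O, θ, φ)` ⇒ `NoseLift₀ k n H ι Z hZ ∅ _`» (`LiftNose.noseLift₀_empty_of_models`)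

res-L1-w45b-nose-w1 g7 (WIDTH seat D-0157 DOOR 1; desk RULING R78 (iv) / R77a (ii): «D9/D11 become droppable LATER by the two repackaging S-lemmas (ν3ᵈ / ν3ᶜⁱ
are instances of the ν-lift door with `S = ∅`) — never in the same REPLACE»).  This module files the COMMON CORE of those repackagings ONCE: the slot
`NoseLift₀` (res-type-027 ✓ `…NatResidueHypDefsE8` p713335) at the EMPTY point set is inhabited as soon as, for every admissible base `(O, θ)` and graded lift
`φ`, the nose `Z` has a regular `O`-flat model `𝓦` on `ℙⁿ_O` with exact reduced trace `𝓦.comap (Proj φ) = 𝓘⟨Z⟩` — which is exactly what res-L1-w45b-stub-2's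
smoothings ✓ `planar_trace_smoothing` (ν3ᵈ, D9) and ✓ `CIModel.ci_trace_and_flat` (ν3ᶜⁱ, D11) deliver, and what ✓ `embeddedCurveLiftFact_holds` gives for a regular
`Z̃` (FREE at stage 0).  OURS; NOT a statement of any manuscript ([Hironaka2017] is a candidate under adjudication, nothing of it is asserted); AI-written,
weaker than expert review.  DEF-FREE; no `sorry`; standard axioms.  `--kind proof --supports stmt-ResolutionOfSingularities-20148 --as helper`, counted 0.
EL♮(3) is NOT proved here.

PROOF SHAPE.  (SECTIONS) `𝓢 := ⊤`: `V(⊤) = ∅` is regular and `O`-flat vacuously (`Flat.of_stalkMap`, no stalks; cf. ✓ `Tower.flat_topSubschemeι_comp`), `(⊤).comap _ = ⊤ = 𝓘⟨∅⟩`, `supp ⊤ = ∅`.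
(CENTRE) a blow-up `τ` of `⊤`, resp. `υ` of `𝓘⟨∅⟩ = ⊤`, is an ISOMORPHISM (Literature ✓ `IsBlowup.isIso` + ✓ `isEffectiveCartier_top`); take `C := 𝓦.comap τ`:
regular (`(𝓦.comap τ).subscheme ≅ pullback τ V(𝓦) ≅ V(𝓦)`, Literature ✓ `Scheme.IsRegular.of_isOpenImmersion`), `O`-flat (`V(𝓦.comap τ) ↪ X₁ → ℙⁿ_O → Spec O` is
`iso ≫ (V(𝓦) → Spec O)`), trace `(𝓦.comap τ).comap j₁ = 𝓦.comap (υ ≫ Proj φ) = 𝓘⟨Z⟩.comap υ = 𝓘⟨υ⁻¹ Z⟩ = 𝓘⟨closure υ⁻¹(Z ∖ ∅)⟩` (`comap_vanishingIdeal_of_isIso`: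
along an isomorphism the reduced ideal of `Z` pulls back to the reduced ideal of `υ⁻¹ Z` — the pull-back subscheme is reduced, Literature ✓
`ker_eq_vanishingIdeal_of_isReduced`), and `τ '' supp C = supp 𝓦` is off the generic point of `Y = range (ι ≫ Proj φ)` because its special-fibre trace is
`Z ⊉ range ι` and `Proj φ` is a closed immersion (`support_subset_not_isGenericPoint_of_trace`, the chain-free twin of ✓ `image_support_subset_not_isGenericPoint_of_chain`).
[cite: GortzWedhorn2020, (13.19) and Prop. 13.91] [cite: Liu2002, Prop. 3.1.9] [folklore]
-/

set_option linter.dupNamespace false -- mandated namespace `Summit.<Summit>.<Problem>` of this single-conjunct summit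

noncomputable section

open CategoryTheory CategoryTheory.Limits AlgebraicGeometry TopologicalSpace Topology IsLocalRing
open MvPolynomial
open Literature.AlgebraicGeometry.Resolution
open AlgebraicGeometry.Scheme.IdealSheafData
open Summit.ResolutionOfSingularities.ResolutionOfSingularities.Cruxes.EquisingularLift.StrataSplit

namespace Summit.ResolutionOfSingularities.ResolutionOfSingularities.Cruxes.EquisingularLiftNat.Sections.LiftNose

/-! ## Three chain-free helpers -/

/-- **Along an ISOMORPHISM the reduced ideal of a closed set pulls back to the reduced ideal of its preimage**: `𝓘⟨Z⟩.comap υ = 𝓘⟨υ⁻¹ Z⟩` (the pull-back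
subscheme `pullback υ Z̃ ≅ Z̃` is reduced, so its ideal `= (pullback.fst).ker` is a vanishing ideal, Literature ✓ `ker_eq_vanishingIdeal_of_isReduced`; its range
is `υ⁻¹ Z`, Mathlib `Pullback.range_fst`). [folklore] -/
theorem comap_vanishingIdeal_of_isIso {F₂ F : Scheme.{0}} (υ : F₂ ⟶ F) [IsIso υ] (Z : Set F) (hZ : IsClosed Z) :
    (vanishingIdeal (⟨Z, hZ⟩ : Closeds F)).comap υ = vanishingIdeal (⟨υ ⁻¹' Z, hZ.preimage υ.continuous⟩ : Closeds F₂) := by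
  haveI : IsReduced (vanishingIdeal (⟨Z, hZ⟩ : Closeds F)).subscheme := isReduced_subscheme_vanishingIdeal _
  haveI : IsReduced (pullback υ (vanishingIdeal (⟨Z, hZ⟩ : Closeds F)).subschemeι) :=
    isReduced_of_isOpenImmersion (pullback.snd υ (vanishingIdeal (⟨Z, hZ⟩ : Closeds F)).subschemeι)
  have h := Literature.AlgebraicGeometry.Motives.ker_eq_vanishingIdeal_of_isReduced
    (pullback.fst υ (vanishingIdeal (⟨Z, hZ⟩ : Closeds F)).subschemeι)
  have hrange : Set.range (pullback.fst υ (vanishingIdeal (⟨Z, hZ⟩ : Closeds F)).subschemeι) = υ ⁻¹' Z := by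
    rw [Scheme.Pullback.range_fst, Scheme.IdealSheafData.range_subschemeι, Scheme.IdealSheafData.coe_support_vanishingIdeal]
    rfl
  change (pullback.fst υ (vanishingIdeal (⟨Z, hZ⟩ : Closeds F)).subschemeι).ker = _
  rw [h]
  congr 1
  exact Closeds.ext hrange

/-- **A blow-up of the EMPTY closed set is an isomorphism** (`𝓘⟨∅⟩ = ⊤` is an effective Cartier divisor; Literature ✓ `IsBlowup.isIso`, ✓ `isEffectiveCartier_top`).
[folklore] -/
theorem isIso_of_isBlowup_vanishingIdeal_empty {F₂ F : Scheme.{0}} (υ : F₂ ⟶ F) (hE0 : IsClosed (∅ : Set F))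
    (hυ : IsBlowup υ (vanishingIdeal (⟨∅, hE0⟩ : Closeds F))) : IsIso υ := by
  have hbot : (⟨∅, hE0⟩ : Closeds F) = ⊥ := Closeds.ext rfl
  rw [hbot, vanishingIdeal_bot] at hυ
  exact hυ.isIso isEffectiveCartier_top

/-- **E1-legality without the chain**: on a scheme `P` with a closed immersion `j : F ⟶ P` of the special fibre, an ideal sheaf `𝓦` whose exact reduced
special-fibre trace `𝓦.comap j = 𝓘⟨Z⟩` does NOT contain the closed irreducible `T` (`¬ T ⊆ Z`) has support off the generic point of `Y := j '' T`.
(= ✓ `image_support_subset_not_isGenericPoint_of_chain` with the chain's fibre lemma replaced by the hypothesis `Y ⊆ range j`.) [OURS · elementary topology] -/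
theorem support_subset_not_isGenericPoint_of_trace {F P : Scheme.{0}} (j : F ⟶ P) [IsClosedImmersion j] (T Z : Set F) (hZ : IsClosed Z)
    (hTZ : ¬ T ⊆ Z) (𝓦 : P.IdealSheafData) (h𝓦 : 𝓦.comap j = vanishingIdeal (⟨Z, hZ⟩ : Closeds F)) :
    (𝓦.support : Set P) ⊆ {y | ¬ IsGenericPoint y (j '' T)} := by
  intro p hp hgen
  apply hTZ
  -- `p` lies in `j '' T`, say `p = j y`
  have hpY : p ∈ j '' T := hgen.mem
  obtain ⟨y, -, rfl⟩ := hpY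
  -- `y ∈ Z` by the trace
  have hyZ : y ∈ Z := by
    have h1 : y ∈ ((𝓦.comap j).support : Set F) := by rw [Scheme.IdealSheafData.support_comap]; exact hp
    rw [h𝓦, Scheme.IdealSheafData.coe_support_vanishingIdeal] at h1
    exact h1
  -- `T ⊆ closure {y} ⊆ Z`
  have hce : IsClosedEmbedding j := j.isClosedEmbedding
  intro t ht
  have htY : j t ∈ closure ({j y} : Set P) := by
    rw [isGenericPoint_def.mp hgen]; exact ⟨t, ht, rfl⟩
  have hty : t ∈ closure ({y} : Set F) := by
    rw [hce.isInducing.closure_eq_preimage_closure_image, Set.image_singleton]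
    exact htY
  exact hZ.closure_subset_iff.mpr (Set.singleton_subset_iff.mpr hyZ) hty

/-! ## The `S = ∅` instance of `NoseLift₀` -/

/-- ★ **`NoseLift₀ k n H ι Z hZ ∅ _` FROM MODELS OF THE NOSE** (WIDTH TABLE D15; desk R78 (iv) «repackaging S-lemmas», common core): if for every admissible base
`(O, θ)` and graded lift `φ` the nose `Z ⊆ range ι` (`range ι ⊄ Z`) has a regular `O`-flat model `𝓦` on `ℙⁿ_O` with `𝓦.comap (Proj φ) = 𝓘⟨Z⟩`, then the ν-lift slot
holds at the EMPTY point set: sections `⊤`, and on any blow-up `τ` of `⊤` (an isomorphism) the centre `𝓦.comap τ`.  See the module docstring for the five checks.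
[OURS · L1 W4.5b · D15 instance lemma; counted 0; EL♮(3) NOT proved] -/
theorem noseLift₀_empty_of_models (k : Type) [Field k] (n : ℕ) (H : AlgebraicGeometry.Scheme.{0})
    (ι : H ⟶ (Literature.AlgebraicGeometry.Motives.projectiveSpace n k).left)
    (Z : Set (Literature.AlgebraicGeometry.Motives.projectiveSpace n k).left) (hZ : IsClosed Z) (hTZ : ¬ (Set.range ι ⊆ Z))
    (hE0 : IsClosed (∅ : Set (Literature.AlgebraicGeometry.Motives.projectiveSpace n k).left))
    (hW : ∀ (O : Type) [CommRing O] [IsDomain O] [IsDiscreteValuationRing O] [IsAdicComplete (IsLocalRing.maximalIdeal O) O]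
      [IsAlgClosed (IsLocalRing.ResidueField O)] (θ : O →+* k), Function.Surjective θ →
      (letI := MvPolynomial.gradedAlgebra (σ := Fin (n + 1)) (R := O); letI := MvPolynomial.gradedAlgebra (σ := Fin (n + 1)) (R := k);
       ∀ (φ : MvPolynomial.homogeneousSubmodule (Fin (n + 1)) O →+*ᵍ MvPolynomial.homogeneousSubmodule (Fin (n + 1)) k)
        (hφ' : HomogeneousIdeal.irrelevant (MvPolynomial.homogeneousSubmodule (Fin (n + 1)) k) ≤ (HomogeneousIdeal.irrelevant (MvPolynomial.homogeneousSubmodule (Fin (n + 1)) O)).map φ),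
        (∀ s, φ s = MvPolynomial.map θ s) →
        ∃ 𝓦 : (AlgebraicGeometry.Proj (MvPolynomial.homogeneousSubmodule (Fin (n + 1)) O)).IdealSheafData,
          Literature.AlgebraicGeometry.Resolution.Scheme.IsRegular 𝓦.subscheme ∧
          AlgebraicGeometry.Flat (𝓦.subschemeι ≫ (AlgebraicGeometry.Proj.toSpecZero (MvPolynomial.homogeneousSubmodule (Fin (n + 1)) O) ≫ AlgebraicGeometry.Spec.map (CommRingCat.ofHom (algebraMap O (MvPolynomial.homogeneousSubmodule (Fin (n + 1)) O 0))))) ∧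
          𝓦.comap (AlgebraicGeometry.Proj.map φ hφ' : (Literature.AlgebraicGeometry.Motives.projectiveSpace n k).left ⟶ (AlgebraicGeometry.Proj (MvPolynomial.homogeneousSubmodule (Fin (n + 1)) O))) =
            vanishingIdeal (⟨Z, hZ⟩ : Closeds (Literature.AlgebraicGeometry.Motives.projectiveSpace n k).left))) :
    NoseLift₀ k n H ι Z hZ ∅ hE0 := by
  classical
  intro O _ _ _ _ _ θ hθ
  letI := MvPolynomial.gradedAlgebra (σ := Fin (n + 1)) (R := O)
  letI := MvPolynomial.gradedAlgebra (σ := Fin (n + 1)) (R := k)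
  intro φ hφ' hφ
  obtain ⟨𝓦, h𝓦reg, h𝓦fl, h𝓦tr⟩ := hW O θ hθ φ hφ' hφ
  -- `Proj φ` is a closed immersion (base change of `Spec θ` along the base model square)
  haveI : IsClosedImmersion (Spec.map (CommRingCat.ofHom θ)) := IsClosedImmersion.spec_of_surjective _ hθ
  haveI hgci : IsClosedImmersion (AlgebraicGeometry.Proj.map φ hφ' : (Literature.AlgebraicGeometry.Motives.projectiveSpace n k).left ⟶ (AlgebraicGeometry.Proj (MvPolynomial.homogeneousSubmodule (Fin (n + 1)) O))) :=
    MorphismProperty.IsStableUnderBaseChange.of_isPullback (ProjectiveAmbientFibre.isPullback_projMap θ φ hφ hθ hφ').flip inferInstance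
  -- the empty closed set of `ℙⁿ_k` is `⊥`
  have hbot : (⟨∅, hE0⟩ : Closeds (Literature.AlgebraicGeometry.Motives.projectiveSpace n k).left) = ⊥ := Closeds.ext rfl
  refine ⟨⊤, fun x => isEmptyElim x, Flat.of_stalkMap _ fun x => isEmptyElim x, ?_, ?_, ?_⟩
  · rw [Scheme.IdealSheafData.comap_top, hbot, vanishingIdeal_bot]
    rfl
  · rw [Scheme.IdealSheafData.support_top]
    exact fun _ h => h.elim
  -- (CENTRE): `τ`, `υ` are blow-ups of unit ideals, hence isomorphisms; the centre is `𝓦.comap τ`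
  intro X₁ τ hτ F₂ υ hυ j₁ t₁ _hsq hcomm
  haveI hτi : IsIso τ := hτ.isIso isEffectiveCartier_top
  haveI hυi : IsIso υ := isIso_of_isBlowup_vanishingIdeal_empty υ hE0 hυ
  refine ⟨𝓦.comap τ, ?_, ?_, ?_, ?_⟩
  · -- regular: `V(𝓦.comap τ) ≅ pullback τ V(𝓦)`, and `pullback.snd` is an isomorphism onto the regular `V(𝓦)`
    have h1 : Scheme.IsRegular (pullback τ 𝓦.subschemeι) := Scheme.IsRegular.of_isOpenImmersion (pullback.snd τ 𝓦.subschemeι) h𝓦reg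
    exact Scheme.IsRegular.of_isOpenImmersion (𝓦.comapIso τ).hom h1
  · -- flat: `V(𝓦.comap τ) ↪ X₁ → ℙⁿ_O → Spec O` = `(iso) ≫ V(𝓦) ↪ ℙⁿ_O → Spec O`
    have heq : (𝓦.comap τ).subschemeι ≫ τ ≫ (AlgebraicGeometry.Proj.toSpecZero (MvPolynomial.homogeneousSubmodule (Fin (n + 1)) O) ≫ AlgebraicGeometry.Spec.map (CommRingCat.ofHom (algebraMap O (MvPolynomial.homogeneousSubmodule (Fin (n + 1)) O 0)))) =
        ((𝓦.comapIso τ).hom ≫ pullback.snd τ 𝓦.subschemeι) ≫ 𝓦.subschemeι ≫ (AlgebraicGeometry.Proj.toSpecZero (MvPolynomial.homogeneousSubmodule (Fin (n + 1)) O) ≫ AlgebraicGeometry.Spec.map (CommRingCat.ofHom (algebraMap O (MvPolynomial.homogeneousSubmodule (Fin (n + 1)) O 0)))) := by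
      rw [Category.assoc, ← pullback.condition_assoc, Scheme.IdealSheafData.comapIso_hom_fst_assoc]
    rw [heq]
    exact (MorphismProperty.cancel_left_of_respectsIso @Flat _ _).mpr h𝓦fl
  · -- trace: `(𝓦.comap τ).comap j₁ = 𝓦.comap (υ ≫ Proj φ) = 𝓘⟨Z⟩.comap υ = 𝓘⟨υ⁻¹ Z⟩ = 𝓘⟨closure υ⁻¹ (Z ∖ ∅)⟩`
    rw [← Scheme.IdealSheafData.comap_comp, hcomm, Scheme.IdealSheafData.comap_comp]
    refine Eq.trans (congrArg (fun I => Scheme.IdealSheafData.comap I υ) h𝓦tr) ?_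
    rw [comap_vanishingIdeal_of_isIso]
    congr 1
    refine Closeds.ext ?_
    change υ ⁻¹' Z = closure (υ ⁻¹' (Z \ ∅))
    rw [Set.sdiff_empty, ((hZ.preimage υ.continuous)).closure_eq]
  · -- off the generic point of `Y`: `τ '' supp (𝓦.comap τ) ⊆ supp 𝓦`, whose trace `Z` does not contain `range ι`
    have hY : (AlgebraicGeometry.Proj.map φ hφ' : (Literature.AlgebraicGeometry.Motives.projectiveSpace n k).left ⟶ (AlgebraicGeometry.Proj (MvPolynomial.homogeneousSubmodule (Fin (n + 1)) O))) '' Set.range ι =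
        Set.range (ι ≫ (AlgebraicGeometry.Proj.map φ hφ' : (Literature.AlgebraicGeometry.Motives.projectiveSpace n k).left ⟶ (AlgebraicGeometry.Proj (MvPolynomial.homogeneousSubmodule (Fin (n + 1)) O)))) := by
      rw [← Set.range_comp]; rfl
    rintro _ ⟨x, hx, rfl⟩ hgen
    have hx' : τ x ∈ (𝓦.support : Set (AlgebraicGeometry.Proj (MvPolynomial.homogeneousSubmodule (Fin (n + 1)) O))) := by
      rw [Scheme.IdealSheafData.support_comap] at hx
      exact hx
    rw [← hY] at hgen
    exact support_subset_not_isGenericPoint_of_trace (AlgebraicGeometry.Proj.map φ hφ' : (Literature.AlgebraicGeometry.Motives.projectiveSpace n k).left ⟶ (AlgebraicGeometry.Proj (MvPolynomial.homogeneousSubmodule (Fin (n + 1)) O))) (Set.range ι) Z hZ hTZ 𝓦 h𝓦tr hx' hgen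

end Summit.ResolutionOfSingularities.ResolutionOfSingularities.Cruxes.EquisingularLiftNat.Sections.LiftNose

end
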